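import Summits.NavierStokesRegularity.FunctionalMining.NoGo.TopEigNormSublinear
import Summits.NavierStokesRegularity.FunctionalMining.NoGo.TopEigHeatTwoShell
import Summits.NavierStokesRegularity.FunctionalMining.TopEigStrainHeatLine
import HarnessLib

/-!
# NO-GO K44b — the SHARP (`N_q`-sublinear) form of the shifted heat identity and of the two-shell
# sandwich of K39 (door (c), node K6, Lemma L-λ(q); both cores, every real `q ≥ 1`)

search for candidate a priori estimates; no regularity claim. Cell `pub-nsfunc`, nogo seat (gen 50),
file K44b; sequel of the tree's K39 `NoGo/TopEigHeatTwoShell` (`heatDissipation_topEigMoment_shift`,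
`twoShell_sandwich_top`, …) using K44a `NoGo/TopEigNormSublinear` (`N_q = Φ_q^{1/q}` is a seminorm on smooth
fields). Static convex calculus of `Φ_q = ∫(λ₁⁺)^q` / `∫((−λ₃)⁺)^q` on smooth periodic fields; nothing about
Navier–Stokes dynamics. No node is decided: `TopEig.TopEigHeatCoercivePos q` stays OPEN for every real `q > 1`.

WHAT IS PROVED (`q ≥ 1`, `N = N_q`, `Φ = Φ_q`, `hD = heatDissipation Φ_q`).
§2 `Δv = −c₁v − z` (`v, z` smooth): K39's identity `hD v = q c₁ Φ(v) − m`, `m` = right derivative at `0` of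
  `σ ↦ Φ(v − σz)`, becomes — chain rule through `x ↦ x^q` at `N(v)`, `n(σ) := N(v − σz)` CONVEX (K44a) —
  **`heatDissipation_topEigMoment_shift_norm : hD v = q c₁ Φ(v) − q N(v)^{q−1} n′(0⁺)`**, whence for every
  `τ > 0` the SHARP SECANT BOUNDS (`…_shift_norm_ge/_le`)
  `q c₁ Φ(v) + q N(v)^{q−1}(N(v) − N(v − τz))/τ ≤ hD v ≤ q c₁ Φ(v) + q N(v)^{q−1}(N(v + τz) − N(v))/τ`,
  which DOMINATE K39's (`shift_bounds_dominate`, by the tangent inequality `N^q − M^q ≤ q N^{q−1}(N − M)`).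
§3 The `−λ₃` core via `v ↦ −v`.
§4 TWO SHELLS `v = u + w`, `Δu = −c₁u`, `Δw = −c₂w`, `c₁ < c₂`: **`twoShell_norm_sandwich_top/negBot`**
  `q N(v)^{q−1}[c₂ N(v) − (c₂ − c₁) N(u)] ≤ hD v ≤ q N(v)^{q−1}[(c₂ − c₁) N(u + 2w) − (c₂ − 2c₁) N(v)]`;
  **`twoShell_norm_lt_of_kill`**: a kill `hD v < c Φ(v)` forces `(q c₂ − c) N(v) < q(c₂ − c₁) N(u)` — for
  `c ≤ q c₁` the low shell ALONE carries MORE `L^q`-norm of `λ₁⁺` than the whole field, the threshold factor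
  `(q c₂ − c)/(q(c₂ − c₁))` being `≥ 1` (`> 1` iff `c < q c₁`) (K39: only the moment version
  `Φ(u)/Φ(v) > 1 + (q c₁ − c)/(c₂ − c₁)`, weaker by Bernoulli); **`twoShell_kill_of_norm_drop`**:
  `q[(c₂ − c₁) N(u + 2w) − (c₂ − 2c₁) N(v)] < c N(v)` IS a kill at rate `c` — a certified design window for
  the WANTED (F2) = `¬ TopEigHeatCoercivePos q`, non-void as a condition as soon as `c₂ > 2c₁` (K39's
  moment window needs `q c₁ − c < c₂ − c₁`);
  **`twoShell_coercive_of_norm_le`**: `N(u) ≤ ρ N(v)` ⇒ `hD v ≥ q(c₂ − (c₂ − c₁)ρ) Φ(v)`.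
MEANING for door (c): what a two-shell (F2) design must control is the `L^q`-NORM ratio `N(u)/N(u + w)`
(resp. `N(u + 2w)/N(u + w)`) against the sharp thresholds above; K42/K43 (symmetry ⇒ ratio ≤ 1 ⇒ rate `q c₁`)
are unchanged. No sharpness claim beyond the two-point data `N(v ∓ τz)`. [ours, calibration / bookkeeping;
one-sided calculus of convex functions: Mathlib `Analysis.Convex.Deriv`]
search for candidate a priori estimates; no regularity claim.
FILING (prove seat g29, REQUEST #70): declarations byte-identical to the no-go seat's staged `TopEigHeatTwoShellNorm.STAGING.lean` 049f1d68d2b5d8f8; this line is the only addition (re-cut from the v2 docstring correction).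
-/

noncomputable section

open MeasureTheory Set Filter Topology

namespace Summit.NavierStokesRegularity.FunctionalMining

open Literature.Analysis.FunctionSpaces Literature.Analysis.FluidPDE

namespace TopEig

variable {d : Type*} [Fintype d] [DecidableEq d]

/-! ## 2. The shifted heat identity in `N_q`-form; the sharp secant bounds (`λ₁` core) -/

/-- **Shifted heat identity, `N_q`-form.** `Δv = −c₁v − z`, `q ≥ 1`: the convex slice
`n(σ) = N_q(v − σz)` has a right derivative `n′(0⁺)` at `0`, and
`heatDissipation Φ_q v = q c₁ Φ_q(v) − q N_q(v)^{q−1} n′(0⁺)`. [ours, calibration] -/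
theorem heatDissipation_topEigMoment_shift_norm [Nonempty d] {q : ℝ} (hq : 1 ≤ q) {c₁ : ℝ}
    {v z : UnitAddTorus d → EuclideanSpace ℝ d} (hv : Torus.IsSmooth v) (hz : Torus.IsSmooth z)
    (hΔ : Torus.laplacian v = -(c₁ • v) - z) :
    HasDerivWithinAt (fun σ : ℝ => topEigNorm q (v + σ • (-z)))
        (derivWithin (fun σ : ℝ => topEigNorm q (v + σ • (-z))) (Set.Ioi 0) 0) (Set.Ioi 0) 0 ∧
      heatDissipation (torusTopEigMoment q) v = q * c₁ * torusTopEigMoment q v -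
        q * topEigNorm q v ^ (q - 1) *
          derivWithin (fun σ : ℝ => topEigNorm q (v + σ • (-z))) (Set.Ioi 0) 0 := by
  have hq0 : q ≠ 0 := by positivity
  set n : ℝ → ℝ := fun σ => topEigNorm q (v + σ • (-z)) with hn_def
  have hconv : ConvexOn ℝ univ n := convexOn_topEigNorm_line hq hv hz.neg
  have hn : HasDerivWithinAt n (derivWithin n (Set.Ioi 0) 0) (Set.Ioi 0) 0 :=
    hconv.hasDerivWithinAt_rightDeriv_of_mem_interior (by simp)
  refine ⟨hn, ?_⟩
  obtain ⟨-, hD⟩ := heatDissipation_topEigMoment_shift hq hv hz hΔ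
  have hn0 : n 0 = topEigNorm q v := by simp [hn_def]
  have hpow : HasDerivAt (fun x : ℝ => x ^ q) (q * n 0 ^ (q - 1)) (n 0) :=
    Real.hasDerivAt_rpow_const (Or.inr hq)
  have hcomp : HasDerivWithinAt (fun σ => n σ ^ q) (q * n 0 ^ (q - 1) * derivWithin n (Set.Ioi 0) 0)
      (Set.Ioi 0) 0 := hpow.comp_hasDerivWithinAt 0 hn
  have hfun : (fun σ : ℝ => torusTopEigMoment q (v + σ • (-z))) = fun σ => n σ ^ q := by
    funext σ
    exact (topEigNorm_rpow hq0 _).symm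
  rw [hD, hfun, hcomp.derivWithin (uniqueDiffWithinAt_Ioi 0), hn0]

/-- **Sharp lower secant bound (`λ₁` core)**: `Δv = −c₁v − z`, `q ≥ 1`, `τ > 0` ⇒
`q c₁ Φ_q(v) + q N_q(v)^{q−1} (N_q(v) − N_q(v − τz))/τ ≤ heatDissipation Φ_q v`. [ours, calibration] -/
theorem heatDissipation_topEigMoment_shift_norm_ge [Nonempty d] {q : ℝ} (hq : 1 ≤ q) {c₁ : ℝ}
    {v z : UnitAddTorus d → EuclideanSpace ℝ d} (hv : Torus.IsSmooth v) (hz : Torus.IsSmooth z)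
    (hΔ : Torus.laplacian v = -(c₁ • v) - z) {τ : ℝ} (hτ : 0 < τ) :
    q * c₁ * torusTopEigMoment q v +
        q * topEigNorm q v ^ (q - 1) * ((topEigNorm q v - topEigNorm q (v + τ • (-z))) / τ) ≤
      heatDissipation (torusTopEigMoment q) v := by
  obtain ⟨-, hD⟩ := heatDissipation_topEigMoment_shift_norm hq hv hz hΔ
  have hconv : ConvexOn ℝ univ (fun σ : ℝ => topEigNorm q (v + σ • (-z))) :=
    convexOn_topEigNorm_line hq hv hz.neg
  have hsl := hconv.rightDeriv_le_slope_of_mem_interior (x := 0) (by simp) (mem_univ τ) hτ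
  rw [slope_def_field, zero_smul, add_zero, sub_zero] at hsl
  have hP : 0 ≤ q * topEigNorm q v ^ (q - 1) :=
    mul_nonneg (by linarith) (Real.rpow_nonneg (topEigNorm_nonneg q v) _)
  have h := mul_le_mul_of_nonneg_left hsl hP
  rw [hD, show (topEigNorm q v - topEigNorm q (v + τ • -z)) / τ =
      -((topEigNorm q (v + τ • -z) - topEigNorm q v) / τ) by ring]
  linarith

/-- **Sharp upper secant bound (`λ₁` core)**: `Δv = −c₁v − z`, `q ≥ 1`, `τ > 0` ⇒
`heatDissipation Φ_q v ≤ q c₁ Φ_q(v) + q N_q(v)^{q−1} (N_q(v + τz) − N_q(v))/τ`. [ours, calibration] -/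
theorem heatDissipation_topEigMoment_shift_norm_le [Nonempty d] {q : ℝ} (hq : 1 ≤ q) {c₁ : ℝ}
    {v z : UnitAddTorus d → EuclideanSpace ℝ d} (hv : Torus.IsSmooth v) (hz : Torus.IsSmooth z)
    (hΔ : Torus.laplacian v = -(c₁ • v) - z) {τ : ℝ} (hτ : 0 < τ) :
    heatDissipation (torusTopEigMoment q) v ≤
      q * c₁ * torusTopEigMoment q v +
        q * topEigNorm q v ^ (q - 1) * ((topEigNorm q (v + τ • z) - topEigNorm q v) / τ) := by
  obtain ⟨-, hD⟩ := heatDissipation_topEigMoment_shift_norm hq hv hz hΔ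
  have hconv : ConvexOn ℝ univ (fun σ : ℝ => topEigNorm q (v + σ • (-z))) :=
    convexOn_topEigNorm_line hq hv hz.neg
  have hneg : -τ < 0 := by linarith
  have h1 := hconv.slope_le_leftDeriv_of_mem_interior (x := -τ) (y := 0) (mem_univ _) (by simp) hneg
  have h2 := hconv.leftDeriv_le_rightDeriv_of_mem_interior (x := 0) (by simp)
  rw [slope_def_field, zero_smul, add_zero, neg_smul, smul_neg, neg_neg, sub_neg_eq_add, zero_add,
    show (topEigNorm q v - topEigNorm q (v + τ • z)) / τ =
      -((topEigNorm q (v + τ • z) - topEigNorm q v) / τ) by ring] at h1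
  have hP : 0 ≤ q * topEigNorm q v ^ (q - 1) :=
    mul_nonneg (by linarith) (Real.rpow_nonneg (topEigNorm_nonneg q v) _)
  have h := mul_le_mul_of_nonneg_left (h1.trans h2) hP
  rw [hD]
  linarith

/-- **The `N_q` secant bounds dominate K39's** (`heatDissipation_topEigMoment_shift_ge/_le`): for any field
`x` (there `x = v ∓ τz`) and `τ > 0`, `(Φ(v) − Φ(x))/τ ≤ q N(v)^{q−1}(N(v) − N(x))/τ` and
`q N(v)^{q−1}(N(x) − N(v))/τ ≤ (Φ(x) − Φ(v))/τ` (tangent inequality of `r ↦ r^q` at `N(v)`, tree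
`rpow_sub_rpow_le_tangent`; `Φ = N^q`). [ours, bookkeeping] -/
theorem shift_bounds_dominate {q : ℝ} (hq : 1 ≤ q) (v x : UnitAddTorus d → EuclideanSpace ℝ d)
    {τ : ℝ} (hτ : 0 < τ) :
    (torusTopEigMoment q v - torusTopEigMoment q x) / τ ≤
        q * topEigNorm q v ^ (q - 1) * ((topEigNorm q v - topEigNorm q x) / τ) ∧
      q * topEigNorm q v ^ (q - 1) * ((topEigNorm q x - topEigNorm q v) / τ) ≤
        (torusTopEigMoment q x - torusTopEigMoment q v) / τ := by
  have hq0 : q ≠ 0 := by positivity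
  have hB : torusTopEigMoment q v - torusTopEigMoment q x ≤
      q * topEigNorm q v ^ (q - 1) * (topEigNorm q v - topEigNorm q x) := by
    rcases hq.eq_or_lt with h1 | hq1
    · rw [← topEigNorm_rpow hq0 v, ← topEigNorm_rpow hq0 x, ← h1, sub_self, Real.rpow_zero, Real.rpow_one,
        Real.rpow_one]
      linarith
    · have h := rpow_sub_rpow_le_tangent hq1 (topEigNorm_nonneg q v) (topEigNorm_nonneg q x)
      rwa [topEigNorm_rpow hq0, topEigNorm_rpow hq0] at h
  have h1 := div_le_div_of_nonneg_right hB hτ.le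
  have e : q * topEigNorm q v ^ (q - 1) * (topEigNorm q v - topEigNorm q x) / τ =
      q * topEigNorm q v ^ (q - 1) * ((topEigNorm q v - topEigNorm q x) / τ) := by ring
  refine ⟨by rw [← e]; exact h1, ?_⟩
  rw [show q * topEigNorm q v ^ (q - 1) * ((topEigNorm q x - topEigNorm q v) / τ) =
      -(q * topEigNorm q v ^ (q - 1) * (topEigNorm q v - topEigNorm q x) / τ) by ring,
    show (torusTopEigMoment q x - torusTopEigMoment q v) / τ =
      -((torusTopEigMoment q v - torusTopEigMoment q x) / τ) by ring]
  exact neg_le_neg h1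

/-! ## 3. The `−λ₃` core (via `v ↦ −v`) -/

/-- **Sharp lower secant bound, `−λ₃` core.** [ours, calibration] -/
theorem heatDissipation_negBotEigMoment_shift_norm_ge [Nonempty d] {q : ℝ} (hq : 1 ≤ q) {c₁ : ℝ}
    {v z : UnitAddTorus d → EuclideanSpace ℝ d} (hv : Torus.IsSmooth v) (hz : Torus.IsSmooth z)
    (hΔ : Torus.laplacian v = -(c₁ • v) - z) {τ : ℝ} (hτ : 0 < τ) :
    q * c₁ * torusNegBotEigMoment q v +
        q * negBotEigNorm q v ^ (q - 1) *
          ((negBotEigNorm q v - negBotEigNorm q (v + τ • (-z))) / τ) ≤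
      heatDissipation (torusNegBotEigMoment q) v := by
  have hΔ' : Torus.laplacian (-v) = -(c₁ • -v) - -z := by
    rw [torus_laplacian_neg', hΔ, smul_neg]; abel
  have h := heatDissipation_topEigMoment_shift_norm_ge hq hv.neg hz.neg hΔ' hτ
  rw [heatDissipation_neg, torusTopEigMoment_neg, ← torusNegBotEigMoment_eq_comp_neg q, neg_neg,
    show -v + τ • z = -(v + τ • -z) by rw [smul_neg, neg_add, neg_neg], topEigNorm_neg, topEigNorm_neg] at h
  exact h

/-- **Sharp upper secant bound, `−λ₃` core.** [ours, calibration] -/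
theorem heatDissipation_negBotEigMoment_shift_norm_le [Nonempty d] {q : ℝ} (hq : 1 ≤ q) {c₁ : ℝ}
    {v z : UnitAddTorus d → EuclideanSpace ℝ d} (hv : Torus.IsSmooth v) (hz : Torus.IsSmooth z)
    (hΔ : Torus.laplacian v = -(c₁ • v) - z) {τ : ℝ} (hτ : 0 < τ) :
    heatDissipation (torusNegBotEigMoment q) v ≤
      q * c₁ * torusNegBotEigMoment q v +
        q * negBotEigNorm q v ^ (q - 1) * ((negBotEigNorm q (v + τ • z) - negBotEigNorm q v) / τ) := by
  have hΔ' : Torus.laplacian (-v) = -(c₁ • -v) - -z := by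
    rw [torus_laplacian_neg', hΔ, smul_neg]; abel
  have h := heatDissipation_topEigMoment_shift_norm_le hq hv.neg hz.neg hΔ' hτ
  rw [heatDissipation_neg, torusTopEigMoment_neg, ← torusNegBotEigMoment_eq_comp_neg q,
    show -v + τ • -z = -(v + τ • z) by rw [smul_neg, neg_add], topEigNorm_neg, topEigNorm_neg] at h
  exact h

/-! ## 4. Two shells: the sharp sandwich and the kill criteria in `N_q`-form -/

section TwoShell

variable [Nonempty d] {q c₁ c₂ : ℝ} {u w : UnitAddTorus d → EuclideanSpace ℝ d}

omit [Fintype d] [DecidableEq d] [Nonempty d] in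
/-- `(u + w) − (c₂ − c₁)⁻¹ • ((c₂ − c₁) • w) = u` (`c₁ < c₂`); re-proved because K39's copy is `private`.
[bookkeeping] -/
private theorem twoShell_sub' (h12 : c₁ < c₂) :
    (u + w) + (1 / (c₂ - c₁)) • (-((c₂ - c₁) • w)) = u := by
  have hne : c₂ - c₁ ≠ 0 := (sub_pos.mpr h12).ne'
  rw [smul_neg, smul_smul, one_div_mul_cancel hne, one_smul]; abel

omit [Fintype d] [DecidableEq d] [Nonempty d] in
/-- `(u + w) + (c₂ − c₁)⁻¹ • ((c₂ − c₁) • w) = u + 2 • w` (`c₁ < c₂`); re-proved because K39's copy is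
`private`. [bookkeeping] -/
private theorem twoShell_add' (h12 : c₁ < c₂) :
    (u + w) + (1 / (c₂ - c₁)) • ((c₂ - c₁) • w) = u + (2 : ℝ) • w := by
  have hne : c₂ - c₁ ≠ 0 := (sub_pos.mpr h12).ne'
  rw [smul_smul, one_div_mul_cancel hne, one_smul, two_smul]; abel

omit [Nonempty d] in
/-- `Φ_q = N_q^{q−1} · N_q` (`q ≥ 1`). [bookkeeping] -/
private theorem moment_eq_norm_mul (hq : 1 ≤ q) (v : UnitAddTorus d → EuclideanSpace ℝ d) :
    torusTopEigMoment q v = topEigNorm q v ^ (q - 1) * topEigNorm q v := by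
  have hq0 : q ≠ 0 := by positivity
  rw [← topEigNorm_rpow hq0 v]
  rcases (topEigNorm_nonneg q v).eq_or_lt with h0 | hpos
  · rw [← h0, Real.zero_rpow hq0, mul_zero]
  · rw [Real.rpow_sub_one hpos.ne', div_mul_cancel₀ _ hpos.ne']

omit [Nonempty d] in
/-- `∫((−λ₃)⁺)^q = (N⁻_q)^{q−1} · N⁻_q` (`q ≥ 1`). [bookkeeping] -/
private theorem negMoment_eq_norm_mul (hq : 1 ≤ q) (v : UnitAddTorus d → EuclideanSpace ℝ d) :
    torusNegBotEigMoment q v = negBotEigNorm q v ^ (q - 1) * negBotEigNorm q v := by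
  rw [← torusTopEigMoment_neg, ← topEigNorm_neg]
  exact moment_eq_norm_mul hq (-v)

/-- **Sharp two-shell sandwich (`λ₁` core).** `Δu = −c₁u`, `Δw = −c₂w`, `c₁ < c₂`, `q ≥ 1`, `N = N_q`,
`v = u + w`: `q N(v)^{q−1} [c₂ N(v) − (c₂ − c₁) N(u)] ≤ heatDissipation Φ_q v ≤
q N(v)^{q−1} [(c₂ − c₁) N(u + 2w) − (c₂ − 2c₁) N(v)]`. [ours, calibration] -/
theorem twoShell_norm_sandwich_top (hq : 1 ≤ q) (h12 : c₁ < c₂) (hu : Torus.IsSmooth u)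
    (hw : Torus.IsSmooth w) (hΔu : Torus.laplacian u = -(c₁ • u))
    (hΔw : Torus.laplacian w = -(c₂ • w)) :
    q * topEigNorm q (u + w) ^ (q - 1) *
          (c₂ * topEigNorm q (u + w) - (c₂ - c₁) * topEigNorm q u) ≤
        heatDissipation (torusTopEigMoment q) (u + w) ∧
      heatDissipation (torusTopEigMoment q) (u + w) ≤
        q * topEigNorm q (u + w) ^ (q - 1) *
          ((c₂ - c₁) * topEigNorm q (u + (2 : ℝ) • w) - (c₂ - 2 * c₁) * topEigNorm q (u + w)) := by
  have hgap : 0 < c₂ - c₁ := sub_pos.mpr h12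
  have hτ : 0 < 1 / (c₂ - c₁) := by positivity
  have hΔ := laplacian_twoShell hu hw hΔu hΔw
  have hz : Torus.IsSmooth ((c₂ - c₁) • w) := Torus.IsSmooth.smul _ hw
  have h1 := heatDissipation_topEigMoment_shift_norm_ge hq (hu.add hw) hz hΔ hτ
  have h2 := heatDissipation_topEigMoment_shift_norm_le hq (hu.add hw) hz hΔ hτ
  rw [twoShell_sub' h12, one_div, div_inv_eq_mul, moment_eq_norm_mul hq (u + w)] at h1
  rw [twoShell_add' h12, one_div, div_inv_eq_mul, moment_eq_norm_mul hq (u + w)] at h2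
  constructor
  · linarith
  · linarith

/-- **Sharp two-shell sandwich (`−λ₃` core).** [ours, calibration] -/
theorem twoShell_norm_sandwich_negBot (hq : 1 ≤ q) (h12 : c₁ < c₂) (hu : Torus.IsSmooth u)
    (hw : Torus.IsSmooth w) (hΔu : Torus.laplacian u = -(c₁ • u))
    (hΔw : Torus.laplacian w = -(c₂ • w)) :
    q * negBotEigNorm q (u + w) ^ (q - 1) *
          (c₂ * negBotEigNorm q (u + w) - (c₂ - c₁) * negBotEigNorm q u) ≤
        heatDissipation (torusNegBotEigMoment q) (u + w) ∧
      heatDissipation (torusNegBotEigMoment q) (u + w) ≤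
        q * negBotEigNorm q (u + w) ^ (q - 1) *
          ((c₂ - c₁) * negBotEigNorm q (u + (2 : ℝ) • w) - (c₂ - 2 * c₁) * negBotEigNorm q (u + w)) := by
  have hgap : 0 < c₂ - c₁ := sub_pos.mpr h12
  have hτ : 0 < 1 / (c₂ - c₁) := by positivity
  have hΔ := laplacian_twoShell hu hw hΔu hΔw
  have hz : Torus.IsSmooth ((c₂ - c₁) • w) := Torus.IsSmooth.smul _ hw
  have h1 := heatDissipation_negBotEigMoment_shift_norm_ge hq (hu.add hw) hz hΔ hτ
  have h2 := heatDissipation_negBotEigMoment_shift_norm_le hq (hu.add hw) hz hΔ hτ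
  rw [twoShell_sub' h12, one_div, div_inv_eq_mul, negMoment_eq_norm_mul hq (u + w)] at h1
  rw [twoShell_add' h12, one_div, div_inv_eq_mul, negMoment_eq_norm_mul hq (u + w)] at h2
  constructor
  · linarith
  · linarith

/-- **Necessary condition for a two-shell kill, `N_q`-form**: `heatDissipation Φ (u+w) < c Φ(u+w)` forces
`(q c₂ − c) N(u + w) < q (c₂ − c₁) N(u)` (both cores); for `c ≤ q c₁` the threshold ratio
`(q c₂ − c)/(q (c₂ − c₁))` is `≥ 1` (`> 1` iff `c < q c₁`). [ours, calibration] -/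
theorem twoShell_norm_lt_of_kill (hq : 1 ≤ q) (h12 : c₁ < c₂) (hu : Torus.IsSmooth u)
    (hw : Torus.IsSmooth w) (hΔu : Torus.laplacian u = -(c₁ • u))
    (hΔw : Torus.laplacian w = -(c₂ • w)) (c : ℝ) :
    (heatDissipation (torusTopEigMoment q) (u + w) < c * torusTopEigMoment q (u + w) →
        (q * c₂ - c) * topEigNorm q (u + w) < q * (c₂ - c₁) * topEigNorm q u) ∧
      (heatDissipation (torusNegBotEigMoment q) (u + w) < c * torusNegBotEigMoment q (u + w) →
        (q * c₂ - c) * negBotEigNorm q (u + w) < q * (c₂ - c₁) * negBotEigNorm q u) := by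
  refine ⟨fun hk => ?_, fun hk => ?_⟩
  · have h := (twoShell_norm_sandwich_top hq h12 hu hw hΔu hΔw).1
    rw [moment_eq_norm_mul hq (u + w)] at hk
    have hP : 0 ≤ topEigNorm q (u + w) ^ (q - 1) := Real.rpow_nonneg (topEigNorm_nonneg q _) _
    by_contra hcon
    have hcon' := not_lt.mp hcon
    have h0 : 0 ≤ topEigNorm q (u + w) ^ (q - 1) *
        ((q * c₂ - c) * topEigNorm q (u + w) - q * (c₂ - c₁) * topEigNorm q u) :=
      mul_nonneg hP (by linarith)
    nlinarith
  · have h := (twoShell_norm_sandwich_negBot hq h12 hu hw hΔu hΔw).1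
    rw [negMoment_eq_norm_mul hq (u + w)] at hk
    have hP : 0 ≤ negBotEigNorm q (u + w) ^ (q - 1) := Real.rpow_nonneg (negBotEigNorm_nonneg q _) _
    by_contra hcon
    have hcon' := not_lt.mp hcon
    have h0 : 0 ≤ negBotEigNorm q (u + w) ^ (q - 1) *
        ((q * c₂ - c) * negBotEigNorm q (u + w) - q * (c₂ - c₁) * negBotEigNorm q u) :=
      mul_nonneg hP (by linarith)
    nlinarith

/-- **Sufficient condition for a two-shell kill, `N_q`-form** (a design window for (F2)):
`q[(c₂ − c₁) N(u + 2w) − (c₂ − 2c₁) N(u + w)] < c N(u + w)` ⇒ `heatDissipation Φ (u+w) < c Φ(u+w)`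
(both cores). [ours, calibration] -/
theorem twoShell_kill_of_norm_drop (hq : 1 ≤ q) (h12 : c₁ < c₂) (hu : Torus.IsSmooth u)
    (hw : Torus.IsSmooth w) (hΔu : Torus.laplacian u = -(c₁ • u))
    (hΔw : Torus.laplacian w = -(c₂ • w)) (c : ℝ) :
    (q * ((c₂ - c₁) * topEigNorm q (u + (2 : ℝ) • w) - (c₂ - 2 * c₁) * topEigNorm q (u + w)) <
          c * topEigNorm q (u + w) →
        heatDissipation (torusTopEigMoment q) (u + w) < c * torusTopEigMoment q (u + w)) ∧
      (q * ((c₂ - c₁) * negBotEigNorm q (u + (2 : ℝ) • w) - (c₂ - 2 * c₁) * negBotEigNorm q (u + w)) <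
          c * negBotEigNorm q (u + w) →
        heatDissipation (torusNegBotEigMoment q) (u + w) < c * torusNegBotEigMoment q (u + w)) := by
  have hgap : 0 < c₂ - c₁ := sub_pos.mpr h12
  have hq0 : 0 ≤ q := by linarith
  refine ⟨fun hk => ?_, fun hk => ?_⟩
  · have h := (twoShell_norm_sandwich_top hq h12 hu hw hΔu hΔw).2
    have hN2 := topEigNorm_nonneg q (u + (2 : ℝ) • w)
    have hNpos : 0 < topEigNorm q (u + w) := by
      by_contra hle
      have hN0 : topEigNorm q (u + w) = 0 := le_antisymm (not_lt.mp hle) (topEigNorm_nonneg _ _)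
      rw [hN0] at hk
      nlinarith [mul_nonneg (mul_nonneg hq0 hgap.le) hN2]
    have hP : 0 < topEigNorm q (u + w) ^ (q - 1) := Real.rpow_pos_of_pos hNpos _
    rw [moment_eq_norm_mul hq (u + w)]
    nlinarith [mul_lt_mul_of_pos_left hk hP]
  · have h := (twoShell_norm_sandwich_negBot hq h12 hu hw hΔu hΔw).2
    have hN2 := negBotEigNorm_nonneg q (u + (2 : ℝ) • w)
    have hNpos : 0 < negBotEigNorm q (u + w) := by
      by_contra hle
      have hN0 : negBotEigNorm q (u + w) = 0 := le_antisymm (not_lt.mp hle) (negBotEigNorm_nonneg _ _)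
      rw [hN0] at hk
      nlinarith [mul_nonneg (mul_nonneg hq0 hgap.le) hN2]
    have hP : 0 < negBotEigNorm q (u + w) ^ (q - 1) := Real.rpow_pos_of_pos hNpos _
    rw [negMoment_eq_norm_mul hq (u + w)]
    nlinarith [mul_lt_mul_of_pos_left hk hP]

/-- **Coercivity from a norm ratio**: `N(u) ≤ ρ N(u + w)` ⇒ `q (c₂ − (c₂ − c₁)ρ) Φ(u + w) ≤ heatDissipation Φ (u+w)`
(both cores; `ρ = 1` is K39 (ii): rate `q c₁`). [ours, calibration] -/
theorem twoShell_coercive_of_norm_le (hq : 1 ≤ q) (h12 : c₁ < c₂) (hu : Torus.IsSmooth u)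
    (hw : Torus.IsSmooth w) (hΔu : Torus.laplacian u = -(c₁ • u))
    (hΔw : Torus.laplacian w = -(c₂ • w)) (ρ : ℝ) :
    (topEigNorm q u ≤ ρ * topEigNorm q (u + w) →
        q * (c₂ - (c₂ - c₁) * ρ) * torusTopEigMoment q (u + w) ≤
          heatDissipation (torusTopEigMoment q) (u + w)) ∧
      (negBotEigNorm q u ≤ ρ * negBotEigNorm q (u + w) →
        q * (c₂ - (c₂ - c₁) * ρ) * torusNegBotEigMoment q (u + w) ≤
          heatDissipation (torusNegBotEigMoment q) (u + w)) := by
  have hgap : 0 < c₂ - c₁ := sub_pos.mpr h12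
  have hq0 : 0 ≤ q := by linarith
  refine ⟨fun hle => ?_, fun hle => ?_⟩
  · have h := (twoShell_norm_sandwich_top hq h12 hu hw hΔu hΔw).1
    have hP : 0 ≤ q * topEigNorm q (u + w) ^ (q - 1) :=
      mul_nonneg hq0 (Real.rpow_nonneg (topEigNorm_nonneg q _) _)
    have h3 := mul_le_mul_of_nonneg_left (mul_le_mul_of_nonneg_left hle hgap.le) hP
    rw [moment_eq_norm_mul hq (u + w)]
    nlinarith
  · have h := (twoShell_norm_sandwich_negBot hq h12 hu hw hΔu hΔw).1
    have hP : 0 ≤ q * negBotEigNorm q (u + w) ^ (q - 1) :=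
      mul_nonneg hq0 (Real.rpow_nonneg (negBotEigNorm_nonneg q _) _)
    have h3 := mul_le_mul_of_nonneg_left (mul_le_mul_of_nonneg_left hle hgap.le) hP
    rw [negMoment_eq_norm_mul hq (u + w)]
    nlinarith

end TwoShell

end TopEig

end Summit.NavierStokesRegularity.FunctionalMining

-- search for candidate a priori estimates; no regularity claim
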